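import Mathlib
import Summits.Langlands.Langlands.Theses.CapacityClassicality

/-!
# Sketch (crux-ideate, ideator 2) — first lemmas for crux `IntegralOverconvergentIsCongruence`

Two `Prop`s, stated over Mathlib + the route file only (no sorry, nothing proved here):

* `KatzSturmGain` — the p-adic Liouville–Cauchy GAIN at the q-expansion level: an
  `r`-overconvergent form (Katz-expansion surrogate, exactly the crux's clause) of weight `w` and
  tame level `Γ₁(N)` whose q-expansion vanishes below order `n₀` has `n₀`-th coefficient of size
  `≤ C · p^{1 + r(1+|w|/(p-1))} · p^{-(12 r /((p-1)·[SL₂(ℤ):Γ₁(N)])) n₀}` — i.e. the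
  Bost–Chambert-Loir capacity rate `(r log p)/s_N`, obtained by truncating the Katz expansion at
  `E_{p-1}^{-M}` and applying Sturm's bound mod `π^e` to the classical truncation.
* `AndreCriterionFiniteGain` — André's one-variable algebraicity criterion (the `d = 1` case of the
  Calegari–Dimitrov–Tang engine, proved in the tree over `ℤ` with archimedean gain as
  `Literature.NumberTheory.DiophantineApproximation.dim_le_of_multiplier_of_denominatorType`)
  transported to a number field `E`, with the archimedean conformal size `‖φ'(0)‖ ≤ 1` ALLOWED and
  compensated by a nonarchimedean gain `R > 1` at one `p`-adic embedding: if
  `log R + [E:ℚ]·log ‖φ'(0)‖ > 0`, an integral, disc-analytic (at every complex embedding),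
  `v`-gaining `y ∈ E⟦x⟧` is algebraic over `E[x]`.
-/

open scoped MatrixGroups
open UpperHalfPlane CongruenceSubgroup Metric

noncomputable section

namespace Summit.Langlands.Langlands.Cruxes.IntegralOverconvergentIsCongruence.Ideator2

/-- **Katz–Sturm gain.** For `p ≥ 5`, `p ∤ N`, weight `w`, Katz data `c_i ∈ M_{w+i(p-1)}(Γ₁(N))`
(q-expansions, complex) with `‖ι⁻¹ c_i‖ ≤ C p^{-ri}` (sup of coefficients), let
`h(n) = Σ_i ι⁻¹[qⁿ](c_i E_{p-1}^{-i})` be the q-coefficients of the overconvergent form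
`H = Σ c_i E_{p-1}^{-i}`. If `h(n) = 0` for `n < n₀` then
`‖h n₀‖ ≤ C p^{1+r(1+|w|/(p-1))} p^{-12 r n₀ /((p-1) μ)}`, `μ = [SL₂(ℤ) : Γ₁(N)]`.
Proof sketch: `H E^M ≡ F_M := Σ_{i≤M} c_i E^{M-i}` (classical, weight `w+M(p-1)`, norm `≤ C`)
up to `C p^{-r(M+1)}`; for `(w+M(p-1))μ/12 < n₀`, Sturm mod `π^e` forces `‖F_M‖ ≤ p C p^{-r(M+1)}`,
whence the bound with the largest admissible `M`. -/
def KatzSturmGain : Prop :=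
  ∀ (p : ℕ) [Fact p.Prime] (hp : 5 ≤ p) (N : ℕ) [NeZero N], ¬ p ∣ N →
  ∀ (w : ℤ) (ι : PadicAlgCl p ≃+* ℂ) (r C : ℝ) (c : ℕ → PowerSeries ℂ), 0 < r → 0 ≤ C →
    (∀ i : ℕ, ∃ F : ModularForm (CongruenceSubgroup.Gamma1 N) (w + i * (p - 1 : ℕ)),
        c i = UpperHalfPlane.qExpansion 1 ⇑F) →
    (∀ i n : ℕ, ‖ι.symm (PowerSeries.coeff n (c i))‖ ≤ C * (p : ℝ) ^ (-(r * i))) →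
    ∀ (h : ℕ → PadicAlgCl p) (n₀ : ℕ),
      (∀ n : ℕ, HasSum (fun i : ℕ ↦ ι.symm (PowerSeries.coeff n
          (c i * ((UpperHalfPlane.qExpansion 1 ⇑(ModularForm.E (show 3 ≤ p - 1 by omega)))⁻¹) ^ i)))
        (h n)) →
      (∀ n, n < n₀ → h n = 0) →
      ‖h n₀‖ ≤ C * (p : ℝ) ^ (1 + r * (1 + |(w : ℝ)| / (p - 1 : ℝ))) *
        (p : ℝ) ^ (-(12 * r / ((p - 1 : ℝ) * ((CongruenceSubgroup.Gamma1 N).index : ℝ)) * n₀))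

/-- The formal Taylor series at `0` of a function `φ : ℂ → ℂ`. [folklore] -/
def taylorSeries (φ : ℂ → ℂ) : PowerSeries ℂ :=
  PowerSeries.mk fun n ↦ iteratedDeriv n φ 0 / n.factorial

/-- **André's algebraicity criterion with a finite-place gain** (one-variable auxiliary polynomial =
the `d = 1` case of Calegari–Dimitrov–Tang's Lemma 2.0.4 with their Dirichlet-exponent `κ`-trick, over
a number field, borderline archimedean size allowed). Data: a number field `E`, a `p`-adic embedding
`ιv`, an integral uniformizer-type series `x(t) ∈ t + t²ℤ⟦t⟧`, a map `φ` holomorphic about the closed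
unit disc with `φ(0) = 0`, `φ'(0) ≠ 0` (size `ρ = ‖φ'(0)‖`, possibly `< 1`), gain constants `B ≥ 1`,
`R > 1` with NET GAIN `log R + [E:ℚ] log ρ > 0`. Conclusion: every `y ∈ E⟦x⟧` which is
(i) `O_E`-integral after `x ↦ x(t)`, (ii) disc-analytic after `φ` at EVERY complex embedding `σ`, and
(iv) `v`-GAINING — every `O_E[x][Y]`-polynomial `Q`, evaluated at `Y = y` and pulled back to `t`, has
its first non-zero coefficient at order `n` of `ιv`-size `≤ A · B^{deg_Y Q + deg_x Q} · R^{-n}` for some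
`A` depending on `y` — is algebraic over `E[x]`. (Proof shape: Siegel over `O_E` by restriction of
scalars with exponent `κ`, bidegree `(D, D)`, `(D+1)² = (1+1/κ)L`; archimedean Cauchy on `|z| = 1` for
`Σ σ(Q_{jk}) φ^k g_σ^j` gives `|σc| ρ^β ≤ sup`; Liouville's `|c| ≥ 1` is replaced by the product formula
`NumberField.prod_abs_eq_one` plus (iv); net `β(log R + [E:ℚ] log ρ) ≤ [E:ℚ] κ L log(1/ρ₀) + O(D)`,
`β ≥ L`, contradiction for `κ` small and `L` large. The tree proves the `ℤ`, `ρ > 1`, no-`v`,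
`d`-variable version as `dim_le_of_multiplier_of_denominatorType`.)
[cite: Andre1989, VIII 1] [cite: CalegariDimitrovTang2025, Lemma 2.0.4 and §§2.1–2.2] -/
def AndreCriterionFiniteGain : Prop :=
  ∀ (E : Type) [Field E] [NumberField E] (p : ℕ) [Fact p.Prime] (ιv : E →+* PadicAlgCl p)
    (x : PowerSeries ℤ), PowerSeries.constantCoeff x = 0 → PowerSeries.coeff 1 x = 1 →
  ∀ (φ : ℂ → ℂ), AnalyticOnNhd ℂ φ (closedBall 0 1) → φ 0 = 0 → deriv φ 0 ≠ 0 →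
  ∀ (B R : ℝ), 1 ≤ B → 1 < R →
    0 < Real.log R + (Module.finrank ℚ E : ℝ) * Real.log ‖deriv φ 0‖ →
  ∀ (y : PowerSeries E),
    -- (i) integrality after the substitution `x ↦ x(t)`
    (∀ n, IsIntegral ℤ (PowerSeries.coeff n (y.subst (x.map (Int.castRingHom E))))) →
    -- (ii) disc-analyticity of `φ^* (σ y)` at every complex embedding
    (∀ σ : E →+* ℂ, ∃ g : ℂ → ℂ, AnalyticOnNhd ℂ g (closedBall 0 1) ∧
      (y.map σ).subst (taylorSeries φ) = taylorSeries g) →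
    -- (iv) the `v`-adic gain on `O_E[x][Y]`-polynomials in `y`, at the first non-zero `t`-coefficient
    (∃ A : ℝ, 0 < A ∧ ∀ Q : Polynomial (Polynomial E), (∀ i j, IsIntegral ℤ ((Q.coeff i).coeff j)) →
      ∀ n : ℕ,
        (∀ n', n' < n → PowerSeries.coeff n'
          (((Q.map (Polynomial.aeval (PowerSeries.X : PowerSeries E)).toRingHom).eval y).subst
            (x.map (Int.castRingHom E))) = 0) →
        ‖ιv (PowerSeries.coeff n
          (((Q.map (Polynomial.aeval (PowerSeries.X : PowerSeries E)).toRingHom).eval y).subst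
            (x.map (Int.castRingHom E))))‖
          ≤ A * B ^ (Q.natDegree + Finset.univ.sup (fun i : Fin (Q.natDegree + 1) ↦
              (Q.coeff i).natDegree)) * R⁻¹ ^ n) →
    ∃ P : Polynomial (Polynomial E), P ≠ 0 ∧
      ((P.map (Polynomial.aeval (PowerSeries.X : PowerSeries E)).toRingHom).eval y) = 0

/-- Sanity (shape only): the crux decl named by this sketch is the route's. -/
example : Summit.Langlands.Langlands.Theses.CapacityClassicality.IntegralOverconvergentIsCongruence →
    Summit.Langlands.Langlands.Theses.CapacityClassicality.IntegralOverconvergentIsCongruence := id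

end Summit.Langlands.Langlands.Cruxes.IntegralOverconvergentIsCongruence.Ideator2

end
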